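import Summits.Ventures.PercRepro.S2DirectCell
import Summits.Ventures.PercRepro.S2ThirteenSixSpreadNine
import Summits.Ventures.PercRepro.RankLevelSetPlaneTenPrime
import Summits.Ventures.PercRepro.S2LPPhi

/-!
# PercRepro — S2: THE `e`-FREE CORE AT LEVEL `5`, RANK `12`, EVERY CORANK `≥ 63` (p7, gen 20; sub-claim S2; the row `p = 12`)

The mirror of S2CoreThirteen's `c025_core_five_at_thirteen_big` at `p = 12`: `#U(12, 5) ≤ C(n, 5)·2^{14}` (every rank-`5` set of the core has
`≤ 19` points), `#Y ≥ Σ_{s=6}^{11} C(n, s) − #{r ≤ 5}` (`choose_sum_six_le_midCount_add`), `#{r ≤ 5} ≤ 16460·C(n, 5)` (`ncard_eRk_le_five_le_of_free`),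
and the sum key `2195988·C(n, 5) ≤ 7·Σ_{s=6}^{11} C(n, s)` (`Φ(12, 5) = 127/7`: `127·16384 + 7·16460 = 2195988`) decided at `n₀ = 75`
(room `1.08`; at `n = 74` it FAILS, `0.995`) and propagated by `key_sum_of_base`: **`c025_core_five_at_twelve_big (M) (hbig : 12 + 62 < |E|)
(hfree) : RLS M 12 5`** — the row `p = 12` at every corank `d ≥ 63` in one theorem. Nothing about the window is claimed. Axioms: standard.
-/

open scoped Matroid

namespace PercRepro

namespace ThmN

open Set

variable {α : Type}

/-- `Σ_{s=6}^{11} C(75, s)`, decided. -/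
theorem sum_choose_seventyfive_six_eleven : ∑ s ∈ Finset.Icc 6 11, (75).choose s = 5871813236480 := by
  decide

/-- The sum key at `p = 12`, `q = 5`, `n₀ = 75`: one numeral (`2^{17}·2195988·C(75, 5) ≤ 7·2^{17}·Σ_{s=6}^{11} C(75, s)`, room `1.08`). -/
theorem key_sum_twelve_five_base :
    2 ^ (12 + 5) * 2195988 * (75).choose 5 ≤ 917504 * ∑ s ∈ Finset.Icc 6 11, (75).choose s := by
  rw [sum_choose_seventyfive_six_eleven]
  norm_num [Nat.choose]

/-- **The `e`-free core at level `5`, rank `12`, every corank `≥ 63`** (`f(5) ≤ 19`): `#U ≤ C(n, 5)·2^{14}`,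
`#Y ≥ Σ_{s=6}^{11} C(n, s) − #{r ≤ 5}`, `#{r ≤ 5} ≤ 16460·C(n, 5)`, and the sum key from `n₀ = 75`. -/
theorem c025_core_five_at_twelve_big (M : Matroid α) [M.Finite] (hbig : 12 + 62 < M.E.ncard)
    (hfree : ∀ e ∈ M.E, ∃ A ⊆ M.E \ {e}, e ∉ M.closure A ∧ e ∉ M.closure ((M.E \ {e}) \ A)) : RLS M 12 5 := by
  classical
  set n := M.E.ncard with hn_def
  have hEcard : M.ground_finite.toFinset.card = n := by
    rw [hn_def, Set.ncard_eq_toFinset_card _ M.ground_finite]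
  have hBq' : ∀ X ⊆ M.E, M.eRk X ≤ 5 → X.ncard ≤ 19 := fun X hX hr =>
    ncard_le_nineteen_of_eRk_le_five_of_free M hfree hX hr
  -- (U): every rank-`5` set has `≤ 19` points
  have hU : Matroid.topCount M 12 5 ≤ n.choose 5 * 2 ^ (19 - 5) := by
    calc Matroid.topCount M 12 5 ≤ Matroid.levelCount M 5 := Matroid.topCount_le_levelCount_bot 12 5
      _ = {X : Set α | X ⊆ M.E ∧ M.eRk X = 5}.ncard := rfl
      _ ≤ n.choose 5 * 2 ^ (19 - 5) := by rw [← hEcard]; exact ncard_eRk_eq_le_choose_mul_of_bound M 5 19 hBq'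
  have hA := ncard_eRk_le_five_le_of_free M (by omega) hfree
  -- (Y): the sizes `6 … 11`
  have hY := choose_sum_six_le_midCount_add M 12
  rw [hEcard] at hY
  simp only [Nat.reduceSub] at hY
  -- the key, propagated from `n₀ = 75`
  have key := key_sum_of_base 12 5 2195988 917504 75 (Finset.Icc 6 11)
    (fun s hs => by rw [Finset.mem_Icc] at hs; omega) (by norm_num)
  have hkey := key key_sum_twelve_five_base n (by omega)
  -- the arithmetic in `ℚ`
  have hU0 : (0 : ℚ) ≤ (Matroid.topCount M 12 5 : ℚ) := by positivity
  have hUq : (Matroid.topCount M 12 5 : ℚ) ≤ (n.choose 5 : ℚ) * 16384 := by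
    have h := hU
    rw [show (19 : ℕ) - 5 = 14 from rfl, show (2 : ℕ) ^ 14 = 16384 from rfl] at h
    exact_mod_cast h
  have hAq : ({X : Set α | X ⊆ M.E ∧ M.eRk X ≤ 5}.ncard : ℚ) ≤ 16460 * (n.choose 5 : ℚ) := by
    exact_mod_cast hA
  have hYq : ((∑ s ∈ Finset.Icc 6 11, n.choose s : ℕ) : ℚ) ≤
      (Matroid.midCount M 12 5 : ℚ) + ({X : Set α | X ⊆ M.E ∧ M.eRk X ≤ 5}.ncard : ℚ) := by
    exact_mod_cast hY
  have hkeyq : (287832539136 : ℚ) * (n.choose 5 : ℚ) ≤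
      917504 * ((∑ s ∈ Finset.Icc 6 11, n.choose s : ℕ) : ℚ) := by
    have h : 287832539136 * n.choose 5 ≤ 917504 * ∑ s ∈ Finset.Icc 6 11, n.choose s := by
      have e : 2 ^ (12 + 5) * 2195988 = 287832539136 := by norm_num
      rw [e] at hkey
      exact hkey
    exact_mod_cast h
  rw [RLS_iff, S2LP.phiK_twelve_five]
  have hpos : (0 : ℚ) ≤ (n.choose 5 : ℚ) := by positivity
  have hΦU : (127 / 7 : ℚ) * (Matroid.topCount M 12 5 : ℚ) ≤
      (127 / 7 : ℚ) * ((n.choose 5 : ℚ) * 16384) := mul_le_mul_of_nonneg_left hUq (by norm_num)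
  refine hΦU.trans ?_
  linarith [hkeyq, hYq, hAq, hpos]

end ThmN

end PercRepro
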